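import Summits.HubbardSuperconductivity.HubbardSuperconductivity.Theorems.AnisotropyChordStiffnessDoobExchangeability
import Summits.HubbardSuperconductivity.HubbardSuperconductivity.Theorems.AnisotropyChordSpinMonotoneFerroCeiling
import Summits.HubbardSuperconductivity.HubbardSuperconductivity.Theorems.AnisotropyChordStiffnessOperatorLink

/-!
# Route `AnisotropyChord` / H0 rotor rung: RUNG FM — (S_tw) HOLDS AT THE FERROMAGNETIC POINT `Δ = 1` with the exact
# constant (theory seat `hubbard-h0-rotor-theory-1`, cycle 10, memo ROTOR-THEORY-10 §145; work-order v10: link F1 and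
# the density bookkeeping)

Theory seat Part M/M5 (tree `…StiffnessDoobGradient/Exchangeability`): a non-negative amplitude uniform on the sector
`S_n` has EXACT Doob winding stiffness `Υ_L(n) = n(V−n)/(V(V−1))` (`windingEnergy_ge_uniform`), and swap-invariant
Perron amplitudes with wall density `≥ 2Υ₀` give `VariationalTwistStiffness Δ M`.  This file supplies the link F1 to
the Hamiltonian and closes the rung:

* `occ_eq_weight` (bookkeeping: number of ones = weight);
* **F1 `perronAmplitude_at_one_uniform`** — at `Δ = 1` the Perron sector ground amplitude of
  `H(1) = xxzHamiltonian 1 (torusGraph 2 L) (−1) 1 = −Σ 𝐒_x·𝐒_y` is UNIFORM on its sector: `a σ = u·[occ σ = W]`,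
  `M = L²/2 − W` (tree `sectorGS_at_one_eq_smul_flatW`: the flat vector attains the sector energy, Perron uniqueness on
  the connected torus);
* `wall_density_at_one` — hence `Σ_σ a(σ)² D_j(σ) = 2W(L²−W)/(L²−1)` for the Perron amplitude;
* **`variationalTwistStiffness_at_one`** : along any density window `ρ_L = 1/2 + M_L/L² → ρ ∈ (0,1)`,
  `VariationalTwistStiffness 1 M` (constant `Υ₀ = ρ(1−ρ)/2`), and the `N`-sector twin
  **`variationalTwistStiffnessN_at_one`**, and in the tree's other (S) predicates `uniformTwistStiffness_at_one`
  (`UniformTwistStiffness 1 M ∧ AxialTwistStiffness 1 M`), `uniformHelicityTensor_at_one` ((S_Υ), both chains) —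
  hypothesis (S) of H0 is a THEOREM at the ferromagnetic point, the first interacting point of the `H(Δ)` family where
  (S) [this file] and BEC [`FerroPointValue`] are both tree theorems: an (S)-side anchor rung (memo §145, §145(j):
  the typed (K) fails there, so this is not an instance of H0's hypotheses).
-/

set_option linter.dupNamespace false

noncomputable section

open Matrix Complex Finset Filter Topology
open Literature.MathematicalPhysics.QuantumLattice hiding torusPhase torusNorm
open Literature.Probability.LatticeModels
open Summit.HubbardSuperconductivity.HubbardSuperconductivity.Theorems.AnisotropyChord.InsertionEntropy
  (IsPerronSectorGroundAmplitude tendsto_density_pred)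

namespace Summit.HubbardSuperconductivity.HubbardSuperconductivity.Theorems.AnisotropyChord.Stiffness.Doob

section FerroPoint

variable {L : ℕ} [NeZero L]

/-- Bookkeeping: the number of ones of a configuration (`Exch.occ`) is its weight `Σ_z σ_z`. [folklore] -/
theorem occ_eq_weight (σ : TensorIndex (TorusSite 2 L) 2) : Exch.occ σ = ∑ z, (σ z : ℕ) := by
  unfold Exch.occ
  rw [Finset.card_filter]
  refine Finset.sum_congr rfl fun z _ => ?_
  rcases fin2_eq_zero_or_one (σ z) with h | h <;> simp [h]

/-- **F1 — the Perron amplitude at the ferromagnetic point is UNIFORM on its sector.**  For a Perron sector ground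
amplitude `a` of `H(1)` in the sector `M` there are `W ≤ L²` and `u` with `M = L²/2 − W` and `a σ = u·[occ σ = W]`
for every `σ` (the flat vector of weight `W` is a sector ground vector of the isotropic ferromagnet and sector ground
vectors are unique up to scalars on the connected torus — tree `sectorGS_at_one_eq_smul_flatW`).
Tasaki (2020) §2.4–2.5. [folklore] -/
theorem perronAmplitude_at_one_uniform (M : ℝ) (a : TensorIndex (TorusSite 2 L) 2 → ℝ)
    (ha : IsPerronSectorGroundAmplitude L 1 M a) :
    ∃ (W : ℕ) (u : ℝ), M = (L : ℝ) ^ 2 / 2 - W ∧ W ≤ L ^ 2 ∧ ∀ σ, a σ = if Exch.occ σ = W then u else 0 := by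
  set ψ : TensorIndex (TorusSite 2 L) 2 → ℂ := fun s => (a s : ℂ) with hψ
  have hψ0 : ψ ≠ 0 := by
    intro h0
    have hz : ∑ σ, a σ ^ 2 = 0 := Finset.sum_eq_zero fun σ _ => by
      have := congrFun h0 σ
      simp only [hψ, Pi.zero_apply, Complex.ofReal_eq_zero] at this
      rw [this]; ring
    rw [ha.unit] at hz
    exact one_ne_zero hz
  obtain ⟨W, ⟨σ₀, hσ₀⟩, hMW⟩ := exists_weight_of_mem_spinZSector ha.sector hψ0
  have hcard : Fintype.card (TorusSite 2 L) = L ^ 2 := by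
    rw [Fintype.card_fun, ZMod.card, Fintype.card_fin]
  -- the flat vector of weight `W`
  set φ : TensorIndex (TorusSite 2 L) 2 → ℂ := fun σ => if (∑ z, (σ z : ℕ)) = W then 1 else 0 with hφdef
  have hφ : ∀ σ, φ σ = if (∑ z, (σ z : ℕ)) = W then 1 else 0 := fun _ => rfl
  have hφ0 : φ ≠ 0 := by
    intro h0
    have := congrFun h0 σ₀
    rw [hφ σ₀, if_pos hσ₀] at this
    exact one_ne_zero this
  have hsec := ha.sector
  have heig := ha.eigen
  rw [hMW] at hsec heig
  obtain ⟨c, hc⟩ := sectorGS_at_one_eq_smul_flatW (torusGraph 2 L) (torusGraph_connected_of_proj 2 L) hφ hφ0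
    hsec heig
  refine ⟨W, c.re, ?_, ?_, ?_⟩
  · rw [hMW, hcard]; push_cast; ring
  · rw [← hσ₀, ← hcard, ← Finset.card_univ]
    calc (∑ z, (σ₀ z : ℕ)) ≤ ∑ _z : TorusSite 2 L, 1 :=
          Finset.sum_le_sum fun z _ => by have := (σ₀ z).isLt; omega
      _ = Finset.univ.card := by simp
  · intro σ
    have h1 : (a σ : ℂ) = c * φ σ := by
      have := congrFun hc σ
      simpa [hψ] using this
    rw [occ_eq_weight]
    have h2 : a σ = (c * φ σ).re := by rw [← h1, Complex.ofReal_re]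
    rw [h2, hφ σ]
    split_ifs <;> simp

/-- **Wall density of the ferromagnetic Perron amplitude:** with `W`, `u` as in F1,
`(L² − 1) · Σ_σ a(σ)² D_j(σ) = 2 W (L² − W)` for each axis (`L ≥ 2`; exchangeability count
`wallCount_mean_uniform`). [folklore] -/
theorem wall_density_at_one (hL : 2 ≤ L) (M : ℝ) (a : TensorIndex (TorusSite 2 L) 2 → ℝ)
    (ha : IsPerronSectorGroundAmplitude L 1 M a) (j : Fin 2) :
    ∃ W : ℕ, M = (L : ℝ) ^ 2 / 2 - W ∧ SwapInvariant a ∧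
      ((L : ℝ) ^ 2 - 1) * ∑ σ, a σ ^ 2 * wallCount j σ = 2 * W * ((L : ℝ) ^ 2 - W) := by
  obtain ⟨W, u, hMW, hW, hunif⟩ := perronAmplitude_at_one_uniform M a ha
  exact ⟨W, hMW, swapInvariant_of_uniform W hunif, wallCount_mean_uniform hL W hW j hunif ha.unit⟩

/-- Density bookkeeping: `W = L²(1 − t)` with `t = 1/2 + M/L²` when `M = L²/2 − W`, and then
`2W(L² − W) = 2L⁴ t(1−t)`. [folklore] -/
theorem two_W_mul (M : ℝ) (W : ℕ) (hMW : M = (L : ℝ) ^ 2 / 2 - W) :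
    2 * (W : ℝ) * ((L : ℝ) ^ 2 - W)
      = 2 * (L : ℝ) ^ 4 * ((1 / 2 + M / (L : ℝ) ^ 2) * (1 - (1 / 2 + M / (L : ℝ) ^ 2))) := by
  have hL : (0 : ℝ) < (L : ℝ) := by exact_mod_cast Nat.pos_of_ne_zero (NeZero.ne L)
  have hW : (W : ℝ) = (L : ℝ) ^ 2 / 2 - M := by linarith
  rw [hW]
  field_simp
  ring

omit [NeZero L] in
/-- The inequality step: `t(1−t) ≥ ρ(1−ρ)/2` and `(L²−1)·S = 2L⁴ t(1−t)` (`L ≥ 2`) give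
`2·(ρ(1−ρ)/2)·L² ≤ S`. [folklore] -/
theorem wall_floor_of_density {ρ t S : ℝ} (hL : 2 ≤ L) (ht : ρ * (1 - ρ) / 2 ≤ t * (1 - t))
    (hS : ((L : ℝ) ^ 2 - 1) * S = 2 * (L : ℝ) ^ 4 * (t * (1 - t))) (hρ : 0 ≤ ρ * (1 - ρ)) :
    2 * (ρ * (1 - ρ) / 2) * (L : ℝ) ^ 2 ≤ S := by
  have hL2 : (2 : ℝ) ≤ (L : ℝ) := by exact_mod_cast hL
  have hL1 : (1 : ℝ) < (L : ℝ) ^ 2 := by nlinarith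
  have hpos : (0 : ℝ) < (L : ℝ) ^ 2 - 1 := by linarith
  -- (L²−1)·S ≥ L⁴ ρ(1−ρ) ≥ (L²−1)·(ρ(1−ρ)/2)·L²
  have h1 : (L : ℝ) ^ 4 * (ρ * (1 - ρ)) ≤ ((L : ℝ) ^ 2 - 1) * S := by
    rw [hS]; nlinarith [pow_nonneg (sq_nonneg (L : ℝ)) 2]
  have h2 : ((L : ℝ) ^ 2 - 1) * (2 * (ρ * (1 - ρ) / 2) * (L : ℝ) ^ 2) ≤ (L : ℝ) ^ 4 * (ρ * (1 - ρ)) := by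
    have hkey : (L : ℝ) ^ 4 * (ρ * (1 - ρ)) - ((L : ℝ) ^ 2 - 1) * (2 * (ρ * (1 - ρ) / 2) * (L : ℝ) ^ 2)
        = ρ * (1 - ρ) * (L : ℝ) ^ 2 := by ring
    have hnn : 0 ≤ ρ * (1 - ρ) * (L : ℝ) ^ 2 := mul_nonneg hρ (sq_nonneg _)
    linarith
  exact le_of_mul_le_mul_left (h2.trans h1) hpos

/-- **RUNG FM: (S_tw) AT THE FERROMAGNETIC POINT (PROVED).**  Along any density window
`ρ_L = 1/2 + M_L/L² → ρ ∈ (0,1)`: `VariationalTwistStiffness 1 M` with `Υ₀ = ρ(1−ρ)/2` — the Perron amplitudes of the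
isotropic ferromagnet are uniform on their sectors (F1), uniform sector states are gradient states with exact Doob
winding stiffness `n(V−n)/(V(V−1))` (Parts M/M5), and the dictionary `DoobWindingStiffness ↔ VariationalTwistStiffness`
transports the floor to the audited φ-form.  Theory seat memo ROTOR-THEORY-10 §145. [folklore] -/
theorem variationalTwistStiffness_at_one (M : ℕ → ℝ) (ρ : ℝ) (hρ : ρ ∈ Set.Ioo (0 : ℝ) 1)
    (hlim : Tendsto (fun L : ℕ => 1 / 2 + M L / (L : ℝ) ^ 2) atTop (𝓝 ρ)) :
    VariationalTwistStiffness 1 M := by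
  have hρ0 : 0 < ρ := hρ.1
  have hρ1 : ρ < 1 := hρ.2
  have hρρ : 0 < ρ * (1 - ρ) := mul_pos hρ0 (by linarith)
  have hlim' := tendsto_density_pred M ρ hlim
  have hprod : Tendsto (fun L : ℕ => (1 / 2 + (M L - 1) / (L : ℝ) ^ 2) * (1 - (1 / 2 + (M L - 1) / (L : ℝ) ^ 2)))
      atTop (𝓝 (ρ * (1 - ρ))) := hlim'.mul (tendsto_const_nhds.sub hlim')
  have hev : ∀ᶠ L : ℕ in atTop, ρ * (1 - ρ) / 2
      ≤ (1 / 2 + (M L - 1) / (L : ℝ) ^ 2) * (1 - (1 / 2 + (M L - 1) / (L : ℝ) ^ 2)) :=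
    hprod.eventually (eventually_ge_nhds (by linarith))
  refine variationalTwistStiffness_of_swapInvariant 1 M (Υ₀ := ρ * (1 - ρ) / 2) (by positivity) ?_
  filter_upwards [hev, eventually_ge_atTop 2] with L ht hL
  intro _ a ha
  obtain ⟨W, u, hMW, hW, hunif⟩ := perronAmplitude_at_one_uniform (M L - 1) a ha
  refine ⟨swapInvariant_of_uniform W hunif, fun j => ?_⟩
  have hS := wallCount_mean_uniform hL W hW j hunif ha.unit
  rw [two_W_mul (M L - 1) W hMW] at hS
  exact wall_floor_of_density hL ht hS hρρ.le

/-- The `N`-sector form of rung FM on the network side: swap-invariant Perron amplitudes of the sectors `M_L` with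
wall density `≥ 2Υ₀` give `DoobWindingStiffnessN Δ M`. [folklore] -/
theorem doobWindingStiffnessN_of_swapInvariant (Δ : ℝ) (M : ℕ → ℝ) {Υ₀ : ℝ} (hΥ : 0 < Υ₀)
    (h : ∀ᶠ L : ℕ in atTop, ∀ [NeZero L], ∀ a : TensorIndex (TorusSite 2 L) 2 → ℝ,
      IsPerronSectorGroundAmplitude L Δ (M L) a →
        SwapInvariant a ∧ ∀ j : Fin 2, 2 * Υ₀ * (L : ℝ) ^ 2 ≤ ∑ σ, a σ ^ 2 * wallCount j σ) :
    DoobWindingStiffnessN Δ M := by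
  refine ⟨Υ₀, hΥ, ?_⟩
  filter_upwards [h] with L hL
  intro _ a ha j g
  exact windingEnergy_ge_of_swapInvariant (hL a ha).1 ha.nonneg j ((hL a ha).2 j) g

/-- **RUNG FM, `N`-sector twin:** along `ρ_L = 1/2 + M_L/L² → ρ ∈ (0,1)`, `VariationalTwistStiffnessN 1 M`
(the one-state chain's stiffness hypothesis holds at the ferromagnetic point). [folklore] -/
theorem variationalTwistStiffnessN_at_one (M : ℕ → ℝ) (ρ : ℝ) (hρ : ρ ∈ Set.Ioo (0 : ℝ) 1)
    (hlim : Tendsto (fun L : ℕ => 1 / 2 + M L / (L : ℝ) ^ 2) atTop (𝓝 ρ)) :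
    VariationalTwistStiffnessN 1 M := by
  have hρ0 : 0 < ρ := hρ.1
  have hρ1 : ρ < 1 := hρ.2
  have hρρ : 0 < ρ * (1 - ρ) := mul_pos hρ0 (by linarith)
  have hprod : Tendsto (fun L : ℕ => (1 / 2 + M L / (L : ℝ) ^ 2) * (1 - (1 / 2 + M L / (L : ℝ) ^ 2)))
      atTop (𝓝 (ρ * (1 - ρ))) := hlim.mul (tendsto_const_nhds.sub hlim)
  have hev : ∀ᶠ L : ℕ in atTop, ρ * (1 - ρ) / 2
      ≤ (1 / 2 + M L / (L : ℝ) ^ 2) * (1 - (1 / 2 + M L / (L : ℝ) ^ 2)) :=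
    hprod.eventually (eventually_ge_nhds (by linarith))
  refine (doobWindingStiffnessN_iff_variationalN 1 M).1
    (doobWindingStiffnessN_of_swapInvariant 1 M (Υ₀ := ρ * (1 - ρ) / 2) (by positivity) ?_)
  filter_upwards [hev, eventually_ge_atTop 2] with L ht hL
  intro _ a ha
  obtain ⟨W, u, hMW, hW, hunif⟩ := perronAmplitude_at_one_uniform (M L) a ha
  refine ⟨swapInvariant_of_uniform W hunif, fun j => ?_⟩
  have hS := wallCount_mean_uniform hL W hW j hunif ha.unit
  rw [two_W_mul (M L) W hMW] at hS
  exact wall_floor_of_density hL ht hS hρρ.le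

/-- **RUNG FM in the tree's (S_tw) predicates:** along `ρ_L → ρ ∈ (0,1)`,
`UniformTwistStiffness 1 M ∧ AxialTwistStiffness 1 M` (tree `uniformTwistStiffness_of_variational`,
`axialTwistStiffness_of_variational`). [folklore] -/
theorem uniformTwistStiffness_at_one (M : ℕ → ℝ) (ρ : ℝ) (hρ : ρ ∈ Set.Ioo (0 : ℝ) 1)
    (hlim : Tendsto (fun L : ℕ => 1 / 2 + M L / (L : ℝ) ^ 2) atTop (𝓝 ρ)) :
    UniformTwistStiffness 1 M ∧ AxialTwistStiffness 1 M :=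
  ⟨uniformTwistStiffness_of_variational 1 M (variationalTwistStiffness_at_one M ρ hρ hlim),
    axialTwistStiffness_of_variational 1 M (variationalTwistStiffness_at_one M ρ hρ hlim)⟩

/-- **(S_Υ) at the ferromagnetic point:** `UniformHelicityTensor 1 M` (hypothesis (S_Υ) of the two-sector chain
`eventualCondensate_of_stiffness_compressibility`) and `UniformHelicityTensorN 1 M` (one-state chain), along
`ρ_L → ρ ∈ (0,1)` (tree `uniformHelicityTensor_of_axial`, `…N_of_axialN`). [folklore] -/
theorem uniformHelicityTensor_at_one (M : ℕ → ℝ) (ρ : ℝ) (hρ : ρ ∈ Set.Ioo (0 : ℝ) 1)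
    (hlim : Tendsto (fun L : ℕ => 1 / 2 + M L / (L : ℝ) ^ 2) atTop (𝓝 ρ)) :
    UniformHelicityTensor 1 M ∧ UniformHelicityTensorN 1 M :=
  ⟨uniformHelicityTensor_of_axial 1 M (uniformTwistStiffness_at_one M ρ hρ hlim).2,
    uniformHelicityTensorN_of_axialN 1 M
      (axialTwistStiffnessN_of_variationalN 1 M (variationalTwistStiffnessN_at_one M ρ hρ hlim))⟩

end FerroPoint

end Summit.HubbardSuperconductivity.HubbardSuperconductivity.Theorems.AnisotropyChord.Stiffness.Doob
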